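import Literature.Combinatorics.SimpleGraph.HamiltonianParitySystem
import HarnessLib

/-!
# A parity-system → directed Hamiltonian cycle gadget construction, II: soundness and the flip symmetry

Continuation of `HamiltonianParitySystem.lean` (support for the discharge of
`Literature.ModelTheory.FiniteModelTheory.AtseriasDawarOchremiak2021_hamiltonicity_countingWidth`).
For the gadget digraph `Arc vr b` of a parity system (`∑ᵢ x_{vr u i} = b u`, `u < m`) we prove:

* **Soundness** (`exists_solution_of_isHamCycleListing`, `exists_solution_of_isHamiltonian`): a
  directed Hamiltonian cycle of `Arc vr b` — equivalently (tree: `isHamiltonian_splitGraph_iff`) a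
  Hamiltonian cycle of its split graph — yields a solution of the system. The argument is LOCAL
  (degree / separator reasoning in the style of Sipser Thm 7.46 and the tree's
  `HamiltonianSatGadget.lean`): the separators force each segment to be passed straight
  (`alpha_cases`, `beta_cases`); directions agree along a chain (`lr_of_isNextOcc`); the chain of a
  variable whose head is not entered from its connector is dead (`rl_of_pred_hd_ne`: right to left, so
  no link leaves its `p` or enters its `q`, `rl_facts`); reading `y v` off the heads (`yv`), the middle
  vertex `bm u i t (t + y (vr u i))` is entered from `bx u i t` and left to `bx u (i+1) (t + y (vr u i))`
  (`pred_bm`, `succ_bm`), so six steps from `bx u 0 s` reach `bx u 3 (s + ∑ᵢ y (vr u i))`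
  (`succ_six_bx`); since `bx u 0 1` is entered from `bx u 3 (b u)`, a violated constraint closes a
  7-cycle (`sum_yv_eq`).
* **Flip symmetry** (`arc_flip_iff`): flipping the variables by `f : Fin n → ZMod 2` — exchanging the
  two chains of `v` when `f v = 1` and translating the tracks of block `u` at level `ℓ` by the prefix
  sum `sigma f u ℓ = ∑_{i<ℓ} f (vr u i)` (`flip`, an involution, `flipEquiv`) — is a digraph
  isomorphism from `Arc vr b` onto `Arc vr (twist f b)`, `twist f b u = b u + ∑ᵢ f (vr u i)`: the
  Cai–Fürer–Immerman mechanism this construction was designed for.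

## References

* A. Atserias, A. Dawar, J. Ochremiak, J. ACM 68 (2021), arXiv:1901.07825, §5.2, Lemma 14.
* M. Sipser, *Introduction to the Theory of Computation*, 3rd ed., Thm 7.46 (separator argument);
  S. Arora, B. Barak, *Computational Complexity*, Thm 2.17.
* J.-Y. Cai, M. Fürer, N. Immerman, Combinatorica 12 (1992), §6 (twists and flips).
-/

namespace Literature.Combinatorics.SimpleGraph

namespace XorHam

open Vtx

variable {n m : ℕ} (vr : Fin m → Fin 3 → Fin n)

/-! ### Soundness: a directed Hamiltonian cycle solves the parity system -/

section Soundness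

variable {vr} {b : Fin m → ZMod 2} {l : List (Vtx n m)} (h : IsHamCycleListing (Arc vr b) l)

/-- Iterating the successor map moves along the listing. [folklore] -/
theorem succ_iterate_getElem (j i : ℕ) (hi : i < l.length) :
    h.succ^[j] l[i] = l[(i + j) % l.length]'(Nat.mod_lt _ (Nat.zero_lt_of_lt hi)) := by
  induction j with
  | zero => simp [Nat.mod_eq_of_lt hi]
  | succ j ih =>
    rw [Function.iterate_succ_apply', ih, h.succ_getElem _ (Nat.mod_lt _ (Nat.zero_lt_of_lt hi))]
    congr 1
    rw [Nat.add_mod ((i + j) % l.length) 1, Nat.mod_mod, ← Nat.add_mod, Nat.add_assoc]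

/-- **No short cycles**: `succ^[j] v ≠ v` for `0 < j < |l|`. [folklore] -/
theorem succ_iterate_ne_self {j : ℕ} (hj : 0 < j) (hjl : j < l.length) (v : Vtx n m) :
    h.succ^[j] v ≠ v := by
  obtain ⟨i, hi, rfl⟩ := h.exists_eq_getElem v
  rw [succ_iterate_getElem h j i hi]
  intro e
  have := (h.nodup.getElem_inj_iff).1 e
  rcases Nat.lt_or_ge (i + j) l.length with hlt | hge
  · rw [Nat.mod_eq_of_lt hlt] at this; omega
  · rw [Nat.mod_eq_sub_mod hge, Nat.mod_eq_of_lt (by omega)] at this; omega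

/-- **The separator `α` is passed straight**: `λ → α → p` (left to right) or `p → α → λ`.
[cite: Sipser2012, Thm. 7.46 (proof)] -/
theorem alpha_cases (h3 : 3 ≤ l.length) (a : ZMod 2) (o : Occ m) :
    (h.pred (nd a o 1) = nd a o 0 ∧ h.succ (nd a o 1) = nd a o 2) ∨
      (h.pred (nd a o 1) = nd a o 2 ∧ h.succ (nd a o 1) = nd a o 0) := by
  have hne := h.pred_ne_succ h3 (nd a o 1)
  rcases arc_alpha_in (h.arc_pred (nd a o 1)) with e | e <;>
    rcases arc_alpha_out (h.arc_succ (nd a o 1)) with e' | e'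
  · exact absurd (e.trans e'.symm) hne
  · exact Or.inl ⟨e, e'⟩
  · exact Or.inr ⟨e, e'⟩
  · exact absurd (e.trans e'.symm) hne

/-- The separator `β` is passed straight: `q → β → ρ` or `ρ → β → q`. [cite: Sipser2012, Thm. 7.46 (proof)] -/
theorem beta_cases (h3 : 3 ≤ l.length) (a : ZMod 2) (o : Occ m) :
    (h.pred (nd a o 4) = nd a o 3 ∧ h.succ (nd a o 4) = nd a o 5) ∨
      (h.pred (nd a o 4) = nd a o 5 ∧ h.succ (nd a o 4) = nd a o 3) := by
  have hne := h.pred_ne_succ h3 (nd a o 4)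
  rcases arc_beta_in (h.arc_pred (nd a o 4)) with e | e <;>
    rcases arc_beta_out (h.arc_succ (nd a o 4)) with e' | e'
  · exact absurd (e.trans e'.symm) hne
  · exact Or.inl ⟨e, e'⟩
  · exact Or.inr ⟨e, e'⟩
  · exact absurd (e.trans e'.symm) hne

/-- **A right-to-left segment is dead for links**: if `α → λ` then `q → p → α`, `β → q` and `ρ → β`
(no link leaves `p` or enters `q`). [cite: Sipser2012, Thm. 7.46 (proof: separator nodes)] -/
theorem rl_facts (h3 : 3 ≤ l.length) {a : ZMod 2} {o : Occ m} (hRL : h.succ (nd a o 1) = nd a o 0) :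
    h.succ (nd a o 2) = nd a o 1 ∧ h.pred (nd a o 3) = nd a o 4 ∧ h.pred (nd a o 4) = nd a o 5 := by
  have hpa : h.pred (nd a o 1) = nd a o 2 := by
    rcases alpha_cases h h3 a o with ⟨-, e⟩ | ⟨e, -⟩
    · rw [hRL] at e; exact absurd e (by simp)
    · exact e
  have hsp : h.succ (nd a o 2) = nd a o 1 := h.succ_eq_iff_pred_eq.2 hpa
  have hpp : h.pred (nd a o 2) = nd a o 3 := by
    rcases arc_p_in (h.arc_pred (nd a o 2)) with e | e
    · exact absurd (e.trans hsp.symm) (h.pred_ne_succ h3 _)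
    · exact e
  have hsq : h.succ (nd a o 3) = nd a o 2 := h.succ_eq_iff_pred_eq.2 hpp
  have hpq : h.pred (nd a o 3) = nd a o 4 := by
    rcases arc_q_in (h.arc_pred (nd a o 3)) with e | e | ⟨t, e⟩
    · exact absurd (e.trans hsq.symm) (h.pred_ne_succ h3 _)
    · exact e
    · exfalso
      -- `β` would be stuck
      have hsb : h.succ (nd a o 4) = nd a o 5 := by
        rcases arc_beta_out (h.arc_succ (nd a o 4)) with e' | e'
        · have := h.succ_eq_iff_pred_eq.1 e'; rw [e] at this; exact absurd this (by simp)
        · exact e'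
      rcases beta_cases h h3 a o with ⟨e', -⟩ | ⟨e', -⟩
      · have := h.succ_eq_iff_pred_eq.2 e'; rw [hsq] at this; exact absurd this (by simp)
      · exact h.pred_ne_succ h3 _ (e'.trans hsb.symm)
  refine ⟨hsp, hpq, ?_⟩
  have hs4 : h.succ (nd a o 4) = nd a o 3 := h.succ_eq_iff_pred_eq.2 hpq
  rcases beta_cases h h3 a o with ⟨-, e⟩ | ⟨e, -⟩
  · rw [hs4] at e; exact absurd e (by simp)
  · exact e

/-- **Directions agree along a chain (backwards)**: if the next slot `o'` is traversed left to
right then so is `o`. [cite: AroraBarakCC2009, Thm. 2.17 (proof: "traversing a chain")] -/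
theorem lr_of_isNextOcc (h3 : 3 ≤ l.length) {a : ZMod 2} {o o' : Occ m} (hn : IsNextOcc vr o o')
    (hLR : h.succ (nd a o' 1) = nd a o' 2) : h.succ (nd a o 1) = nd a o 2 := by
  have hpa' : h.pred (nd a o' 1) = nd a o' 0 := by
    rcases alpha_cases h h3 a o' with ⟨e, -⟩ | ⟨-, e⟩
    · exact e
    · rw [hLR] at e; exact absurd e (by simp)
  have hsl' : h.succ (nd a o' 0) = nd a o' 1 := h.succ_eq_iff_pred_eq.2 hpa'
  -- `λ_{o'}` is entered from `ρ_o`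
  have hpl' : h.pred (nd a o' 0) = nd a o 5 := by
    rcases arc_lam_in (h.arc_pred (nd a o' 0)) with e | ⟨-, hf⟩ | ⟨o'', e, hn''⟩
    · exact absurd (e.trans hsl'.symm) (h.pred_ne_succ h3 _)
    · exact absurd hf hn.not_isFirst
    · rw [hn''.unique_left hn] at e; exact e
  have hsr : h.succ (nd a o 5) = nd a o' 0 := h.succ_eq_iff_pred_eq.2 hpl'
  have hpr : h.pred (nd a o 5) = nd a o 4 := by
    rcases arc_rho_in (h.arc_pred (nd a o 5)) with e | ⟨-, hl⟩ | ⟨o'', e, hn''⟩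
    · exact e
    · exact absurd hl hn.not_isLast
    · rw [hn.unique_right hn''] at hsr
      exact absurd (e.trans hsr.symm) (h.pred_ne_succ h3 _)
  have hsb : h.succ (nd a o 4) = nd a o 5 := h.succ_eq_iff_pred_eq.2 hpr
  have hpb : h.pred (nd a o 4) = nd a o 3 := by
    rcases beta_cases h h3 a o with ⟨e, -⟩ | ⟨-, e⟩
    · exact e
    · rw [hsb] at e; exact absurd e (by simp)
  have hsq : h.succ (nd a o 3) = nd a o 4 := h.succ_eq_iff_pred_eq.2 hpb
  rcases alpha_cases h h3 a o with ⟨-, e⟩ | ⟨-, e⟩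
  · exact e
  · have hpq := (rl_facts h h3 e).2.1
    exact absurd (hpq.trans hsq.symm) (h.pred_ne_succ h3 _)

/-- **A chain whose head is not entered from its connector starts right to left.** [folklore] -/
theorem rl_first_of_pred_hd_ne (h3 : 3 ≤ l.length) {v : Fin n} {a : ZMod 2}
    (hne : h.pred (hd v a) ≠ cx v.castSucc) {o : Occ m} (ho : var vr o = v) (hf : IsFirst vr o) :
    h.succ (nd a o 1) = nd a o 0 := by
  have hph : h.pred (hd v a) = nd a o 0 := by
    rcases arc_hd_in (h.arc_pred (hd v a)) with e | ⟨o', e, ho', hf'⟩ | ⟨-, hocc⟩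
    · exact absurd e hne
    · rw [hf'.eq hf (ho'.trans ho.symm)] at e; exact e
    · exact absurd ⟨o, ho⟩ hocc
  have hsl : h.succ (nd a o 0) = hd v a := h.succ_eq_iff_pred_eq.2 hph
  rcases alpha_cases h h3 a o with ⟨e, -⟩ | ⟨-, e⟩
  · have := h.succ_eq_iff_pred_eq.2 e
    rw [hsl] at this; exact absurd this (by simp)
  · exact e

/-- **… and stays right to left**: every slot of that variable is traversed right to left.
[cite: AroraBarakCC2009, Thm. 2.17 (proof)] -/
theorem rl_of_pred_hd_ne (h3 : 3 ≤ l.length) {v : Fin n} {a : ZMod 2}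
    (hne : h.pred (hd v a) ≠ cx v.castSucc) : ∀ o : Occ m, var vr o = v → h.succ (nd a o 1) = nd a o 0 := by
  intro o
  induction o using WellFounded.induction (InvImage.wf flat wellFounded_lt) with
  | h o ih =>
    intro ho
    by_cases hf : IsFirst vr o
    · exact rl_first_of_pred_hd_ne h h3 hne ho hf
    · obtain ⟨o₀, hn⟩ := exists_isNextOcc_of_not_isFirst hf
      have h₀ := ih o₀ hn.2.1 (hn.1.symm.trans ho)
      rcases alpha_cases h h3 a o with ⟨-, e⟩ | ⟨-, e⟩
      · have := lr_of_isNextOcc h h3 hn e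
        rw [h₀] at this; exact absurd this (by simp)
      · exact e

/-- **The assignment read off a Hamiltonian cycle**: `y v = 1` iff the head of the chain `K(v,1)` is
entered from the connector `cx v` (chains of copy `y v + 1` are then dead). [folklore] -/
noncomputable def yv (v : Fin n) : ZMod 2 :=
  if h.pred (hd v 1) = cx v.castSucc then 1 else 0

/-- The chain of copy `y v + 1` is not entered from the connector. [folklore] -/
theorem pred_hd_yv_add_one_ne (v : Fin n) : h.pred (hd v (yv h v + 1)) ≠ cx v.castSucc := by
  unfold yv
  split_ifs with hp
  · intro e
    have : hd v ((1 : ZMod 2) + 1) = hd v 1 := h.pred_injective (e.trans hp.symm)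
    rw [Vtx.hd.injEq] at this
    exact absurd this.2 (by decide)
  · simpa using hp

/-- Dichotomy in `ZMod 2` used for the links: `t' = t + 1 + a` with `t' = t + y` forces `a = y + 1`.
[folklore] -/
theorem zmod2_link {t y a : ZMod 2} (e : t + y = t + 1 + a) : a = y + 1 := by
  revert t y a; decide

/-- **Dead links**: on the dead chain of `vr u i`, no link leaves `p` … [folklore] -/
theorem succ_p_dead (h3 : 3 ≤ l.length) {o : Occ m} :
    h.succ (nd (yv h (var vr o) + 1) o 2) = nd (yv h (var vr o) + 1) o 1 :=
  (rl_facts h h3 (rl_of_pred_hd_ne h h3 (pred_hd_yv_add_one_ne h _) o rfl)).1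

/-- … and no link enters `q`. [folklore] -/
theorem pred_q_dead (h3 : 3 ≤ l.length) {o : Occ m} :
    h.pred (nd (yv h (var vr o) + 1) o 3) = nd (yv h (var vr o) + 1) o 4 :=
  (rl_facts h h3 (rl_of_pred_hd_ne h h3 (pred_hd_yv_add_one_ne h _) o rfl)).2.1

/-- **The switch is forced**: the middle vertex `bm u i t (t + y (vr u i))` is entered from `bx u i t`.
[folklore] -/
theorem pred_bm (h3 : 3 ≤ l.length) (u : Fin m) (i : Fin 3) (t : ZMod 2) :
    h.pred (bm u i t (t + yv h (vr u i))) = bx u i.castSucc t := by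
  rcases arc_bm_in (h.arc_pred (bm u i t (t + yv h (vr u i)))) with e | ⟨a, o, e, hu, hi, ht⟩
  · exact e
  · exfalso
    have ha : a = yv h (vr u i) + 1 := zmod2_link ht
    have hvo : var vr o = vr u i := by rw [var, hu, hi]
    have hs := h.succ_eq_iff_pred_eq.2 e
    rw [ha, ← hvo, succ_p_dead h h3] at hs
    exact absurd hs (by simp)

/-- … and left to `bx u (i+1) (t + y (vr u i))`. [folklore] -/
theorem succ_bm (h3 : 3 ≤ l.length) (u : Fin m) (i : Fin 3) (t : ZMod 2) :
    h.succ (bm u i t (t + yv h (vr u i))) = bx u i.succ (t + yv h (vr u i)) := by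
  rcases arc_bm_out (h.arc_succ (bm u i t (t + yv h (vr u i)))) with e | ⟨a, o, e, hu, hi, ht⟩
  · exact e
  · exfalso
    have ha : a = yv h (vr u i) + 1 := zmod2_link ht
    have hvo : var vr o = vr u i := by rw [var, hu, hi]
    have hp := h.succ_eq_iff_pred_eq.1 e
    rw [ha, ← hvo, pred_q_dead h h3] at hp
    exact absurd hp (by simp)

/-- **One switch**: two steps from `bx u i t` lead to `bx u (i+1) (t + y (vr u i))`. [folklore] -/
theorem succ_succ_bx (h3 : 3 ≤ l.length) (u : Fin m) (i : Fin 3) (t : ZMod 2) :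
    h.succ (h.succ (bx u i.castSucc t)) = bx u i.succ (t + yv h (vr u i)) := by
  rw [h.succ_eq_iff_pred_eq.2 (pred_bm h h3 u i t), succ_bm h h3 u i t]

/-- **One pass**: six steps from `bx u 0 s` lead to `bx u 3 (s + ∑ᵢ y (vr u i))`. [folklore] -/
theorem succ_six_bx (h3 : 3 ≤ l.length) (u : Fin m) (s : ZMod 2) :
    h.succ^[6] (bx u 0 s) = bx u 3 (s + ∑ i, yv h (vr u i)) := by
  have e0 := succ_succ_bx h h3 u 0 s
  have e1 := succ_succ_bx h h3 u 1 (s + yv h (vr u 0))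
  have e2 := succ_succ_bx h h3 u 2 (s + yv h (vr u 0) + yv h (vr u 1))
  have c0 : ((0 : Fin 3).castSucc : Fin 4) = 0 := rfl
  have c1 : ((1 : Fin 3).castSucc : Fin 4) = 1 := rfl
  have c2 : ((2 : Fin 3).castSucc : Fin 4) = 2 := rfl
  have s0 : ((0 : Fin 3).succ : Fin 4) = 1 := rfl
  have s1 : ((1 : Fin 3).succ : Fin 4) = 2 := rfl
  have s2 : ((2 : Fin 3).succ : Fin 4) = 3 := rfl
  rw [c0, s0] at e0; rw [c1, s1] at e1; rw [c2, s2] at e2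
  show h.succ (h.succ (h.succ (h.succ (h.succ (h.succ (bx u 0 s)))))) = _
  rw [e0, e1, e2, Fin.sum_univ_three, ← add_assoc, ← add_assoc]

/-- **The second pass starts where the first should end**: `bx u 0 1` is entered from `bx u 3 (b u)`.
[folklore] -/
theorem pred_bx_zero_one (u : Fin m) : h.pred (bx u 0 1) = bx u 3 (b u) := by
  rcases arc_bx_zero_in (h.arc_pred (bx u 0 1)) with ⟨-, e⟩ | ⟨e, -⟩
  · exact absurd e (by decide)
  · exact e

/-- **Soundness at one constraint**: the assignment read off a Hamiltonian cycle satisfies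
`∑ᵢ y (vr u i) = b u` (otherwise the second pass closes into a 7-cycle). [folklore] -/
theorem sum_yv_eq (h8 : 8 ≤ l.length) (u : Fin m) : ∑ i, yv h (vr u i) = b u := by
  have h3 : 3 ≤ l.length := by omega
  by_contra hne
  have key : ∀ Y c : ZMod 2, Y ≠ c → 1 + Y = c := by decide
  have h6 := succ_six_bx h h3 u 1
  rw [key _ _ hne] at h6
  have h7 : h.succ^[7] (bx u 0 1) = bx u 0 1 := by
    rw [Function.iterate_succ_apply', h6]
    exact h.succ_eq_iff_pred_eq.2 (pred_bx_zero_one h u)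
  exact succ_iterate_ne_self h (by norm_num) (by omega) _ h7

include h in
/-- **Soundness of the gadget digraph.** If `Arc vr b` has a directed Hamiltonian cycle then the parity
system `∑ᵢ x_{vr u i} = b u` (`u < m`) is solvable over `𝔽₂`. [folklore] -/
theorem exists_solution_of_isHamCycleListing (hm : 0 < m) :
    ∃ x : Fin n → ZMod 2, ∀ u : Fin m, ∑ i, x (vr u i) = b u := by
  refine ⟨yv h, fun u => sum_yv_eq h ?_ u⟩
  rw [h.length_eq, Vtx.card_vtx]
  omega

end Soundness

/-- **Soundness for the split (undirected) graph.** If the split graph of `Arc vr b` is Hamiltonian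
then the parity system is solvable. [folklore] -/
theorem exists_solution_of_isHamiltonian {vr : Fin m → Fin 3 → Fin n} {b : Fin m → ZMod 2}
    (hH : (splitGraph (Arc vr b)).IsHamiltonian) :
    ∃ x : Fin n → ZMod 2, ∀ u : Fin m, ∑ i, x (vr u i) = b u := by
  classical
  rcases Nat.eq_zero_or_pos m with rfl | hm
  · exact ⟨fun _ => 0, fun u => u.elim0⟩
  · obtain ⟨l, -, hl⟩ := (isHamiltonian_splitGraph_iff (Arc vr b)).1 hH
    exact exists_solution_of_isHamCycleListing hl hm



/-! ### Flipping a variable: the Cai–Fürer–Immerman symmetry of the construction -/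

section Flip

variable {vr} (f : Fin n → ZMod 2) {b : Fin m → ZMod 2}

/-- Prefix sums of the flips of the variables of constraint `u`: the translation of the track at
level `ℓ` of block `u`. [folklore] -/
def sigma (u : Fin m) (ℓ : Fin 4) : ZMod 2 :=
  ∑ i : Fin 3, if (i : ℕ) < ℓ then f (vr u i) else 0

/-- **The flip by `f`**: chains of `v` are exchanged when `f v = 1`; block tracks are translated by the
prefix sums. [cite: CaiFurerImmerman1992, §6 (twisting)] -/
def flip : Vtx n m → Vtx n m
  | cx j => cx j
  | ce j => ce j
  | hd v a => hd v (a + f v)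
  | tl v a => tl v (a + f v)
  | nd a o s => nd (a + f (var vr o)) o s
  | bx u ℓ s => bx u ℓ (s + sigma (vr := vr) f u ℓ)
  | bm u i t t' => bm u i (t + sigma (vr := vr) f u i.castSucc) (t' + sigma (vr := vr) f u i.succ)

/-- **The twisted right-hand sides**: `b u + ∑ᵢ f (vr u i)`. [cite: CaiFurerImmerman1992, §6] -/
def twist (b : Fin m → ZMod 2) : Fin m → ZMod 2 := fun u => b u + ∑ i, f (vr u i)

/-- No translation at level `0`. [folklore] -/
@[simp] theorem sigma_zero (u : Fin m) : sigma (vr := vr) f u 0 = 0 := by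
  simp [sigma]

/-- Full translation at level `3`. [folklore] -/
theorem sigma_three (u : Fin m) : sigma (vr := vr) f u 3 = ∑ i, f (vr u i) := by
  unfold sigma
  exact Finset.sum_congr rfl fun i _ => if_pos i.2

/-- One more switch adds one flip. [folklore] -/
theorem sigma_succ (u : Fin m) (i : Fin 3) :
    sigma (vr := vr) f u i.succ = sigma (vr := vr) f u i.castSucc + f (vr u i) := by
  unfold sigma
  fin_cases i <;> simp [Fin.sum_univ_three]

/-- Adding a value of `ZMod 2` twice does nothing. [folklore] -/
theorem add_add_cancel_zmod2 (a c : ZMod 2) : a + c + c = a := by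
  rw [add_assoc, CharTwo.add_self_eq_zero, add_zero]

/-- Flipping twice by the same `f` is the identity. [folklore] -/
theorem flip_flip (x : Vtx n m) : flip (vr := vr) f (flip (vr := vr) f x) = x := by
  cases x <;> simp [flip, add_add_cancel_zmod2]

/-- Twisting twice by the same `f` is the identity. [folklore] -/
theorem twist_twist (b : Fin m → ZMod 2) : twist (vr := vr) f (twist (vr := vr) f b) = b := by
  funext u; simp [twist, add_add_cancel_zmod2]

/-- The flip as a permutation of the vertices. [folklore] -/
def flipEquiv : Vtx n m ≃ Vtx n m where
  toFun := flip (vr := vr) f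
  invFun := flip (vr := vr) f
  left_inv := flip_flip f
  right_inv := flip_flip f

/-- The flip permutation is the flip. [folklore] -/
@[simp] theorem flipEquiv_apply (x : Vtx n m) : flipEquiv (vr := vr) f x = flip (vr := vr) f x := rfl

/-- The link condition is flip-invariant. [folklore] -/
theorem link_flip_iff (t t' a σ c : ZMod 2) :
    t' + (σ + c) = t + σ + 1 + (a + c) ↔ t' = t + 1 + a := by
  revert t t' a σ c; decide

/-- **Equivariance** (one direction): an arc of the system `b` is carried by the flip to an arc of the
twisted system. [cite: CaiFurerImmerman1992, §6 (Lemma 6.2: twists differing by an even number are isomorphic)] -/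
theorem arc_flip {x y : Vtx n m} (hxy : Arc vr b x y) :
    Arc vr (twist (vr := vr) f b) (flip (vr := vr) f x) (flip (vr := vr) f y) := by
  cases x with
  | cx j =>
    cases y with
    | hd v a => simpa only [Arc, flip] using hxy
    | ce j' => simpa only [Arc, flip] using hxy
    | _ => simp only [Arc] at hxy
  | ce j =>
    cases y with
    | cx j' => simpa only [Arc, flip] using hxy
    | bx u ℓ s =>
      simp only [Arc, flip] at hxy ⊢
      obtain ⟨hj, rfl, rfl⟩ := hxy
      exact ⟨hj, rfl, by simp⟩
    | _ => simp only [Arc] at hxy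
  | hd v a =>
    cases y with
    | cx j => simpa only [Arc, flip] using hxy
    | nd a' o s =>
      simp only [Arc, flip] at hxy ⊢
      obtain ⟨rfl, hs, hv, hf⟩ := hxy
      exact ⟨by rw [hv], hs, hv, hf⟩
    | tl v' a' =>
      simp only [Arc, flip] at hxy ⊢
      obtain ⟨rfl, rfl, ho⟩ := hxy
      exact ⟨rfl, rfl, ho⟩
    | _ => simp only [Arc] at hxy
  | tl v a =>
    cases y with
    | hd v' a' =>
      simp only [Arc, flip] at hxy ⊢
      obtain ⟨rfl, rfl, ho⟩ := hxy
      exact ⟨rfl, rfl, ho⟩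
    | nd a' o s =>
      simp only [Arc, flip] at hxy ⊢
      obtain ⟨rfl, hs, hv, hl⟩ := hxy
      exact ⟨by rw [hv], hs, hv, hl⟩
    | tl v' a' =>
      simp only [Arc, flip] at hxy ⊢
      obtain ⟨rfl, ha⟩ := hxy
      exact ⟨rfl, fun e => ha (add_right_cancel e)⟩
    | _ => simp only [Arc] at hxy
  | nd a o s =>
    cases y with
    | hd v a' =>
      simp only [Arc, flip] at hxy ⊢
      obtain ⟨rfl, hs, hv, hf⟩ := hxy
      exact ⟨by rw [hv], hs, hv, hf⟩
    | tl v a' =>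
      simp only [Arc, flip] at hxy ⊢
      obtain ⟨rfl, hs, hv, hl⟩ := hxy
      exact ⟨by rw [hv], hs, hv, hl⟩
    | nd a' o' s' =>
      simp only [Arc, flip] at hxy ⊢
      obtain ⟨rfl, hh⟩ := hxy
      have hv : var vr o = var vr o' := by
        rcases hh with ⟨rfl, -⟩ | ⟨-, -, hn⟩ | ⟨-, -, hn⟩
        · rfl
        · exact hn.1.symm
        · exact hn.1
      exact ⟨by rw [hv], hh⟩
    | bm u i t t' =>
      simp only [Arc, flip] at hxy ⊢
      obtain ⟨hs, rfl, rfl, ht⟩ := hxy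
      refine ⟨hs, rfl, rfl, ?_⟩
      rw [sigma_succ]
      exact (link_flip_iff _ _ _ _ _).2 ht
    | _ => simp only [Arc] at hxy
  | bx u ℓ s =>
    cases y with
    | ce j =>
      simp only [Arc, flip, twist] at hxy ⊢
      obtain ⟨rfl, rfl, hj⟩ := hxy
      exact ⟨rfl, by rw [sigma_three]; abel, hj⟩
    | bm u' i t t' =>
      simp only [Arc, flip] at hxy ⊢
      obtain ⟨rfl, rfl, rfl⟩ := hxy
      exact ⟨rfl, rfl, rfl⟩
    | bx u' ℓ' s' =>
      simp only [Arc, flip, twist] at hxy ⊢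
      obtain ⟨rfl, rfl, rfl, rfl, rfl⟩ := hxy
      exact ⟨rfl, rfl, by rw [sigma_three], rfl, by simp⟩
    | _ => simp only [Arc] at hxy
  | bm u i t t' =>
    cases y with
    | nd a o s =>
      simp only [Arc, flip] at hxy ⊢
      obtain ⟨hs, rfl, rfl, ht⟩ := hxy
      refine ⟨hs, rfl, rfl, ?_⟩
      rw [sigma_succ]
      exact (link_flip_iff _ _ _ _ _).2 ht
    | bx u' ℓ s =>
      simp only [Arc, flip] at hxy ⊢
      obtain ⟨rfl, rfl, rfl⟩ := hxy
      exact ⟨rfl, rfl, rfl⟩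
    | _ => simp only [Arc] at hxy

/-- **Equivariance of the construction**: the flip by `f` is a digraph isomorphism from `Arc vr b` onto
the digraph of the twisted system `twist f b`. [cite: CaiFurerImmerman1992, §6] -/
theorem arc_flip_iff (x y : Vtx n m) :
    Arc vr (twist (vr := vr) f b) (flip (vr := vr) f x) (flip (vr := vr) f y) ↔ Arc vr b x y := by
  refine ⟨fun h => ?_, arc_flip f⟩
  have := arc_flip (b := twist (vr := vr) f b) f h
  rwa [flip_flip, flip_flip, twist_twist] at this

end Flip

end XorHam

end Literature.Combinatorics.SimpleGraph
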